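import Summits.HubbardSuperconductivity.HubbardSuperconductivity.Theorems.AnisotropyChordTransferFibre3TwoHoleBSCertCheck
import Summits.HubbardSuperconductivity.HubbardSuperconductivity.Theorems.AnisotropyChordTransferFibre3TwoHoleBSCertAlgebra

/-!
# Route `AnisotropyChord` / H0 rotor rung: SOUNDNESS of the kernel certificate — `nearCert d C g t t′ η = true` gives the three skeleton facts for `skelA d`

Fifteenth file of the `TwoHoleBS` (PROP BS) chain; joins the computable checker `…TwoHoleBSCertCheck` to the real objects of
`…TwoHoleBSNear{,Inf}` through `…TwoHoleBSCertAlgebra`: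
* index maps `e10Equiv`, `e8Equiv`, `e10 : Fin 5 ⊕ Fin 5 → ℕ`, `e8 : Fin 4 ⊕ Fin 4 → ℕ` (via `finSumFinEquiv`), `sum_e10`, `sum_e8`, `dsum_e10`, `dsum_e8`,
  `liftV10`, `liftV8`, `ipt_eq_iptZN`, `Bslot_e8`, ★ `skelA_eq_AaffR` (`skelA d p q = A(1/π)_{e10 p, e10 q}` for `|d|∞ ≤ 3`,
  from `Subsample.aZ2_eq_aZ2Qz`);
* `quad_pad`, `dsum_ite`, `dsum_const` (bookkeeping of double sums);
* ★ `cnd_of_certN`: `N(u±) ⪰ 0` ⇒ `cᵀ(skelA d)c ≤ −η‖c‖²` on zero-sum `c`;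
* ★ `gap_of_certM`: zero column sums + `M_B(u±) ⪰ 0` ⇒ `wᵀP∞w ≥ g‖w‖²` on zero-sum `w`;
* ★★★ `nearFacts_of_nearCert`: `nearCert d C g t t′ η = true`, `2 ≤ |d|₁`, `|d|∞ ≤ 3` ⇒
  `IsUnit (skelA d).det ∧ 0 < s ∧ (∀ w, Σw = 0 → g‖w‖² ≤ wᵀP∞w)` — exactly the hypotheses of
  `dualCert_threeQuarter_near_of_gap` / `dualCert_threeQuarter_near_eventually_of_gap`.
Prover seat `hubbard-h0-rotor-p2` g3; helper for stmt-HubbardSuperconductivity-19089 (`--supports`, helper class).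
WHAT THIS IS NOT: nothing here proves superconductivity in the Hubbard model; the rotor TARGET as originally worded stays
FALSE (g15 verdict).  Verification plumbing for ONE input (HOLE₂ near-pair skeletons) of ONE conditional reduction (rung 19089).
Mathlib + tree imports only; no sorry, no axioms.
-/

set_option linter.dupNamespace false
set_option autoImplicit false

noncomputable section

open scoped BigOperators

namespace Summit.HubbardSuperconductivity.HubbardSuperconductivity.Theorems.AnisotropyChord.Transfer.Fibre3

namespace TwoHoleBS

open Subsample

/-! ## Index maps between the slot types and `ℕ` -/

/-- the slot type as `Fin 10`. [folklore] -/
def e10Equiv : Fin 5 ⊕ Fin 5 ≃ Fin 10 := finSumFinEquiv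

/-- the boundary type as `Fin 8`. [folklore] -/
def e8Equiv : Fin 4 ⊕ Fin 4 ≃ Fin 8 := finSumFinEquiv

/-- slot index: `inl i ↦ i`, `inr i ↦ 5 + i`. [folklore] -/
def e10 (p : Fin 5 ⊕ Fin 5) : ℕ := (e10Equiv p).val

/-- boundary index: `inl j ↦ j`, `inr j ↦ 4 + j`. [folklore] -/
def e8 (i : Fin 4 ⊕ Fin 4) : ℕ := (e8Equiv i).val

/-- `e10 p < 10`. [folklore] -/
theorem e10_lt (p : Fin 5 ⊕ Fin 5) : e10 p < 10 := (e10Equiv p).isLt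

/-- `e8 i < 8`. [folklore] -/
theorem e8_lt (i : Fin 4 ⊕ Fin 4) : e8 i < 8 := (e8Equiv i).isLt

/-- `e10` is injective. [folklore] -/
theorem e10_inj (p q : Fin 5 ⊕ Fin 5) : e10 p = e10 q ↔ p = q := by
  unfold e10
  rw [← Fin.ext_iff, e10Equiv.injective.eq_iff]

/-- `e8` is injective. [folklore] -/
theorem e8_inj (i j : Fin 4 ⊕ Fin 4) : e8 i = e8 j ↔ i = j := by
  unfold e8
  rw [← Fin.ext_iff, e8Equiv.injective.eq_iff]

/-- reindexing single sums along `e10`. [folklore] -/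
theorem sum_e10 (F : ℕ → ℝ) : ∑ p : Fin 5 ⊕ Fin 5, F (e10 p) = ∑ k ∈ Finset.range 10, F k := by
  unfold e10
  rw [Equiv.sum_comp e10Equiv (fun i : Fin 10 => F i.val)]
  exact Fin.sum_univ_eq_sum_range F 10

/-- reindexing single sums along `e8`. [folklore] -/
theorem sum_e8 (F : ℕ → ℝ) : ∑ i : Fin 4 ⊕ Fin 4, F (e8 i) = ∑ k ∈ Finset.range 8, F k := by
  unfold e8
  rw [Equiv.sum_comp e8Equiv (fun i : Fin 8 => F i.val)]
  exact Fin.sum_univ_eq_sum_range F 8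

/-- reindexing double sums along `e10`. [folklore] -/
theorem dsum_e10 (G : ℕ → ℕ → ℝ) :
    ∑ p : Fin 5 ⊕ Fin 5, ∑ q : Fin 5 ⊕ Fin 5, G (e10 p) (e10 q) = ∑ k ∈ Finset.range 10, ∑ l ∈ Finset.range 10, G k l := by
  rw [← sum_e10 (fun k => ∑ l ∈ Finset.range 10, G k l)]
  exact Finset.sum_congr rfl fun p _ => sum_e10 (G (e10 p))

/-- reindexing double sums along `e8`. [folklore] -/
theorem dsum_e8 (G : ℕ → ℕ → ℝ) :
    ∑ i : Fin 4 ⊕ Fin 4, ∑ j : Fin 4 ⊕ Fin 4, G (e8 i) (e8 j) = ∑ k ∈ Finset.range 8, ∑ l ∈ Finset.range 8, G k l := by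
  rw [← sum_e8 (fun k => ∑ l ∈ Finset.range 8, G k l)]
  exact Finset.sum_congr rfl fun i _ => sum_e8 (G (e8 i))

/-- pushing a slot vector forward to `ℕ` indices. [folklore] -/
def liftV10 (V : Fin 5 ⊕ Fin 5 → ℝ) : ℕ → ℝ :=
  fun k => if h : k < 10 then V (e10Equiv.symm ⟨k, h⟩) else 0

/-- pushing a boundary vector forward to `ℕ` indices. [folklore] -/
def liftV8 (W : Fin 4 ⊕ Fin 4 → ℝ) : ℕ → ℝ :=
  fun k => if h : k < 8 then W (e8Equiv.symm ⟨k, h⟩) else 0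

/-- `liftV10 V (e10 p) = V p`. [folklore] -/
theorem liftV10_e10 (V : Fin 5 ⊕ Fin 5 → ℝ) (p : Fin 5 ⊕ Fin 5) : liftV10 V (e10 p) = V p := by
  unfold liftV10
  rw [dif_pos (e10_lt p)]
  unfold e10
  rw [Fin.eta, Equiv.symm_apply_apply]

/-- `liftV8 W (e8 i) = W i`. [folklore] -/
theorem liftV8_e8 (W : Fin 4 ⊕ Fin 4 → ℝ) (i : Fin 4 ⊕ Fin 4) : liftV8 W (e8 i) = W i := by
  unfold liftV8
  rw [dif_pos (e8_lt i)]
  unfold e8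
  rw [Fin.eta, Equiv.symm_apply_apply]

/-- the integer coordinates on `ℕ` indices agree with `ipt`. [folklore] -/
theorem ipt_eq_iptZN (d : ℤ × ℤ) (p : Fin 5 ⊕ Fin 5) : ipt d p = iptZN d (e10 p) := by
  rcases p with i | i <;> fin_cases i <;> rfl

/-- boundary slots agree: `Bslot (e8 i) = e10 (emb i)`. [folklore] -/
theorem Bslot_e8 (i : Fin 4 ⊕ Fin 4) : Bslot (e8 i) = e10 (TwoChannel.emb i) := by
  rcases i with j | j <;> fin_cases j <;> rfl

/-- ★ the skeleton in affine form: `skelA d p q = A(1/π)_{e10 p, e10 q}` on the window `|d|∞ ≤ 3`. [folklore] -/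
theorem skelA_eq_AaffR (d : ℤ × ℤ) (hwin : d.1.natAbs ≤ 3 ∧ d.2.natAbs ≤ 3) (p q : Fin 5 ⊕ Fin 5) :
    skelA d p q = AaffR d (1 / Real.pi) (e10 p) (e10 q) := by
  have hb := ipt_sub_bound d p q
  have h1 : (ipt d p - ipt d q).1.natAbs ≤ 5 := by
    have := hb.1
    rw [Int.abs_eq_natAbs, Int.abs_eq_natAbs] at this
    omega
  have h2 : (ipt d p - ipt d q).2.natAbs ≤ 5 := by
    have := hb.2
    rw [Int.abs_eq_natAbs, Int.abs_eq_natAbs] at this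
    omega
  simp only [skelA, Matrix.of_apply, AaffR]
  rw [aZ2_eq_aZ2Qz _ _ h1 h2, ipt_eq_iptZN, ipt_eq_iptZN]
  ring

/-! ## Double-sum bookkeeping -/

/-- `ŵᵀXŵ = Σ_{ι,κ} W_ι X_{emb ι, emb κ} W_κ` for `ŵ = pad W`. [folklore] -/
theorem quad_pad (X : Matrix (Fin 5 ⊕ Fin 5) (Fin 5 ⊕ Fin 5) ℝ) (W : Fin 4 ⊕ Fin 4 → ℝ) :
    dotProduct (pad W) (X.mulVec (pad W))
      = ∑ i : Fin 4 ⊕ Fin 4, ∑ j : Fin 4 ⊕ Fin 4, W i * X (TwoChannel.emb i) (TwoChannel.emb j) * W j := by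
  simp only [dotProduct, Matrix.mulVec]
  rw [sum_eq_sum_emb_real (F := fun p => pad W p * ∑ q, X p q * pad W q) (by simp [(pad_centre W).1])
    (by simp [(pad_centre W).2])]
  refine Finset.sum_congr rfl fun i _ => ?_
  rw [pad_emb, sum_eq_sum_emb_real (F := fun q => X (TwoChannel.emb i) q * pad W q)
    (by simp [(pad_centre W).1]) (by simp [(pad_centre W).2]), Finset.mul_sum]
  refine Finset.sum_congr rfl fun j _ => ?_
  rw [pad_emb]; ring

/-- `Σ_{i,j} W_i (a[i=j]) W_j = a‖W‖²`. [folklore] -/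
theorem dsum_ite {ι : Type*} [Fintype ι] [DecidableEq ι] (W : ι → ℝ) (a : ℝ) :
    ∑ i, ∑ j, W i * (if i = j then a else 0) * W j = a * dotProduct W W := by
  simp only [mul_ite, mul_zero, ite_mul, zero_mul, Finset.sum_ite_eq, Finset.mem_univ, if_true, dotProduct,
    Finset.mul_sum]
  exact Finset.sum_congr rfl fun i _ => by ring

/-- `Σ_{i,j} W_i t W_j = t(ΣW)²`. [folklore] -/
theorem dsum_const {ι : Type*} [Fintype ι] (W : ι → ℝ) (t : ℝ) :
    ∑ i, ∑ j, W i * t * W j = t * (∑ i, W i) ^ 2 := by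
  rw [sq, Finset.sum_mul_sum, Finset.mul_sum]
  refine Finset.sum_congr rfl fun i _ => ?_
  rw [Finset.mul_sum]
  exact Finset.sum_congr rfl fun j _ => by ring

/-- `Σ_{i,j} W_i A_{ij} W_j = Wᵀ(AW)`. [folklore] -/
theorem dsum_eq_dot {ι : Type*} [Fintype ι] (A : Matrix ι ι ℝ) (W : ι → ℝ) :
    ∑ i, ∑ j, W i * A i j * W j = dotProduct W (A.mulVec W) := by
  simp only [dotProduct, Matrix.mulVec, Finset.mul_sum]
  exact Finset.sum_congr rfl fun i _ => Finset.sum_congr rfl fun j _ => by ring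

/-! ## ★ The `N`-certificate gives strict conditional negative definiteness -/

/-- ★ `N(u⁻) ⪰ 0`, `N(u⁺) ⪰ 0` ⇒ `cᵀ(skelA d)c ≤ −η‖c‖²` for zero-sum `c`. [folklore] -/
theorem cnd_of_certN (d : ℤ × ℤ) (hwin : d.1.natAbs ≤ 3 ∧ d.2.natAbs ≤ 3) (t η : ℚ)
    (hlo : psdCheck (Nget d t η uLo) 10 = true) (hhi : psdCheck (Nget d t η uHi) 10 = true)
    (c : Fin 5 ⊕ Fin 5 → ℝ) (hc : ∑ r, c r = 0) :
    dotProduct c ((skelA d).mulVec c) ≤ -(η : ℝ) * dotProduct c c := by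
  refine cnd_of_form (skelA d) t η (fun V => ?_) c hc
  set v := liftV10 V with hvdef
  have hv : ∀ p, v (e10 p) = V p := liftV10_e10 V
  have key : ∀ u : ℚ, psdCheck (Nget d t η u) 10 = true →
      0 ≤ (∑ k ∈ Finset.range 10, ∑ l ∈ Finset.range 10, v k * PN d t η k l * v l)
        + (u : ℝ) * (∑ k ∈ Finset.range 10, ∑ l ∈ Finset.range 10, v k * QN d k l * v l) := by
    intro u hu
    have h := psdCheck_sound _ 10 hu v
    simp only [cast_Nget] at h
    rwa [double_sum_affine] at h
  have hmid := affine_nonneg_of_endpoints _ _ _ _ (1 / Real.pi) uLo_le_inv_pi inv_pi_le_uHi (key uLo hlo) (key uHi hhi)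
  rw [← double_sum_affine] at hmid
  -- identify the parameter-`1/π` form with the real one
  have e1 : ∀ k l, PN d t η k l + 1 / Real.pi * QN d k l
      = -AaffR d (1 / Real.pi) k l + (t : ℝ) - (if k = l then (η : ℝ) else 0) := fun k l => (N_affine d t η _ k l).symm
  simp only [e1] at hmid
  rw [← dsum_e10] at hmid
  simp only [hv, e10_inj, ← skelA_eq_AaffR d hwin] at hmid
  have hsplit : ∑ p : Fin 5 ⊕ Fin 5, ∑ q : Fin 5 ⊕ Fin 5,
      V p * (-skelA d p q + (t : ℝ) - if p = q then (η : ℝ) else 0) * V q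
      = -(∑ p : Fin 5 ⊕ Fin 5, ∑ q : Fin 5 ⊕ Fin 5, V p * skelA d p q * V q)
        + (∑ p : Fin 5 ⊕ Fin 5, ∑ q : Fin 5 ⊕ Fin 5, V p * (t : ℝ) * V q)
        - (∑ p : Fin 5 ⊕ Fin 5, ∑ q : Fin 5 ⊕ Fin 5, V p * (if p = q then (η : ℝ) else 0) * V q) := by
    simp only [mul_add, mul_sub, add_mul, sub_mul, Finset.sum_add_distrib, Finset.sum_sub_distrib, neg_mul, mul_neg,
      Finset.sum_neg_distrib]
  rw [hsplit, dsum_eq_dot, dsum_const, dsum_ite] at hmid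
  linarith

/-! ## ★ The `M`-certificate gives the gap of `P∞` on zero-sum vectors -/

/-- the real charge map read off the table. [folklore] -/
def CR (C : List (List ℚ)) : Matrix (Fin 5 ⊕ Fin 5) (Fin 5 ⊕ Fin 5) ℝ :=
  Matrix.of fun p q => (getC C (e10 p) (e10 q) : ℝ)

/-- zero column sums transfer. [folklore] -/
theorem CR_colsum (C : List (List ℚ)) (hC : colSumCheck C = true) (q : Fin 5 ⊕ Fin 5) : ∑ p, CR C p q = 0 := by
  simp only [CR, Matrix.of_apply]
  rw [sum_e10 (fun k => (getC C k (e10 q) : ℝ))]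
  exact colSumCheck_sound C hC _ (e10_lt q)

/-- entries of the real charge matrix `C + Cᵀ + CᵀAC` in affine form. [folklore] -/
theorem chargeMat_apply (d : ℤ × ℤ) (hwin : d.1.natAbs ≤ 3 ∧ d.2.natAbs ≤ 3) (C : List (List ℚ))
    (p q : Fin 5 ⊕ Fin 5) :
    (CR C + (CR C).transpose + (CR C).transpose * skelA d * CR C) p q
      = cf0 d C (e10 p) (e10 q) + (1 / Real.pi) * cf1 d C (e10 p) (e10 q) := by
  rw [← chargeForm_affine]
  simp only [Matrix.add_apply, Matrix.transpose_apply, Matrix.mul_apply, CR, Matrix.of_apply]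
  congr 1
  rw [← dsum_e10 (fun k l => (getC C k (e10 p) : ℝ) * AaffR d (1 / Real.pi) k l * (getC C l (e10 q) : ℝ))]
  simp only [← skelA_eq_AaffR d hwin]
  rw [Finset.sum_comm]
  refine Finset.sum_congr rfl fun l _ => ?_
  rw [Finset.sum_mul]

/-- ★ zero column sums + `M_B(u⁻) ⪰ 0`, `M_B(u⁺) ⪰ 0` ⇒ `wᵀP∞w ≥ g‖w‖²` on zero-sum `w`. [folklore] -/
theorem gap_of_certM (d : ℤ × ℤ) (hwin : d.1.natAbs ≤ 3 ∧ d.2.natAbs ≤ 3) (C : List (List ℚ)) (g t : ℚ)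
    (hC : colSumCheck C = true)
    (hlo : psdCheck (MBget d C g t uLo) 8 = true) (hhi : psdCheck (MBget d C g t uHi) 8 = true)
    (hA : IsUnit (skelA d).det) (hs : TwoChannel.svec2 (skelA d) ≠ 0)
    (hcnd0 : ∀ c : Fin 5 ⊕ Fin 5 → ℝ, ∑ r, c r = 0 → dotProduct c ((skelA d).mulVec c) ≤ 0)
    (w : Fin 4 ⊕ Fin 4 → ℝ) (hw : ∑ i, w i = 0) :
    (g : ℝ) * dotProduct w w ≤ dotProduct w ((twoHolePinf (skelA d)).mulVec w) := by
  refine gap_of_chargeMap (skelA d) (skelA_isSymm d) hA hs hcnd0 (CR C) (CR_colsum C hC) g (fun W hW => ?_) w hw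
  set v := liftV8 W with hvdef
  have hv : ∀ i, v (e8 i) = W i := liftV8_e8 W
  have key : ∀ u : ℚ, psdCheck (MBget d C g t u) 8 = true →
      0 ≤ (∑ k ∈ Finset.range 8, ∑ l ∈ Finset.range 8,
          v k * (cf0 d C (Bslot k) (Bslot l) - (if k = l then ((g : ℝ) + 1 / 2) else 0) + (t : ℝ)) * v l)
        + (u : ℝ) * (∑ k ∈ Finset.range 8, ∑ l ∈ Finset.range 8, v k * cf1 d C (Bslot k) (Bslot l) * v l) := by
    intro u hu
    have h := psdCheck_sound _ 8 hu v
    simp only [cast_MBget] at h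
    rwa [double_sum_affine] at h
  have hmid := affine_nonneg_of_endpoints _ _ _ _ (1 / Real.pi) uLo_le_inv_pi inv_pi_le_uHi (key uLo hlo) (key uHi hhi)
  rw [← double_sum_affine, ← dsum_e8] at hmid
  simp only [hv, e8_inj, Bslot_e8] at hmid
  have hsplit : ∑ i : Fin 4 ⊕ Fin 4, ∑ j : Fin 4 ⊕ Fin 4, W i *
      (cf0 d C (e10 (TwoChannel.emb i)) (e10 (TwoChannel.emb j)) - (if i = j then ((g : ℝ) + 1 / 2) else 0) + (t : ℝ)
        + 1 / Real.pi * cf1 d C (e10 (TwoChannel.emb i)) (e10 (TwoChannel.emb j))) * W j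
      = (∑ i : Fin 4 ⊕ Fin 4, ∑ j : Fin 4 ⊕ Fin 4, W i *
          (cf0 d C (e10 (TwoChannel.emb i)) (e10 (TwoChannel.emb j))
            + 1 / Real.pi * cf1 d C (e10 (TwoChannel.emb i)) (e10 (TwoChannel.emb j))) * W j)
        - (∑ i : Fin 4 ⊕ Fin 4, ∑ j : Fin 4 ⊕ Fin 4, W i * (if i = j then ((g : ℝ) + 1 / 2) else 0) * W j)
        + (∑ i : Fin 4 ⊕ Fin 4, ∑ j : Fin 4 ⊕ Fin 4, W i * (t : ℝ) * W j) := by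
    simp only [mul_add, mul_sub, add_mul, sub_mul, Finset.sum_add_distrib, Finset.sum_sub_distrib]
    ring
  rw [hsplit, dsum_ite, dsum_const, hW] at hmid
  rw [quad_pad]
  simp only [chargeMat_apply d hwin]
  nlinarith

/-! ## ★★★ The three skeleton facts from the kernel certificate -/

/-- the skeleton has zero diagonal. [folklore] -/
theorem skelA_diag (d : ℤ × ℤ) (p : Fin 5 ⊕ Fin 5) : skelA d p p = 0 := by
  simp [skelA, aZ2_zero]

/-- a positive off-diagonal entry: `A_{centre, +eₓ} = 2a_∞(1,0) = ½`. [folklore] -/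
theorem skelA_pos_entry (d : ℤ × ℤ) : 0 < skelA d (Sum.inl 0) (Sum.inl 1) := by
  have h : skelA d (Sum.inl 0) (Sum.inl 1) = 2 * aZ2 (-1) 0 := by
    simp [skelA, ipt, clusterZ]
  rw [h, aZ2_mirror, aZ2_one_zero]
  norm_num

/-- ★★★ **SOUNDNESS OF THE KERNEL CERTIFICATE:** for `2 ≤ |d|₁`, `|d|∞ ≤ 3`: `nearCert d C g t t′ η = true` implies the three
`L`-free skeleton facts of `dualCert_threeQuarter_near_of_gap`: invertibility, `s > 0`, and the gap `g` of `P∞` on zero-sum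
boundary vectors. [folklore] -/
theorem nearFacts_of_nearCert (d : ℤ × ℤ) (hwin : d.1.natAbs ≤ 3 ∧ d.2.natAbs ≤ 3)
    (C : List (List ℚ)) (g t t' η : ℚ) (h : nearCert d C g t t' η = true) :
    IsUnit (skelA d).det ∧ 0 < TwoChannel.svec2 (skelA d) ∧
      ∀ w : Fin 4 ⊕ Fin 4 → ℝ, ∑ i, w i = 0 →
        (g : ℝ) * dotProduct w w ≤ dotProduct w ((twoHolePinf (skelA d)).mulVec w) := by
  simp only [nearCert, Bool.and_eq_true, decide_eq_true_eq] at h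
  obtain ⟨⟨⟨⟨⟨⟨hC, hMlo⟩, hMhi⟩, hNlo⟩, hNhi⟩, hη⟩, _hg⟩ := h
  have hcnd := cnd_of_certN d hwin t' η hNlo hNhi
  have hηr : (0 : ℝ) < η := by exact_mod_cast hη
  have hA := isUnit_det_of_cnd (skelA d) (skelA_isSymm d) (skelA_diag d) (skelA_pos_entry d) η hηr hcnd
  have hs := svec2_pos_of_cnd (skelA d) (skelA_isSymm d) (skelA_diag d) (skelA_pos_entry d) η hηr hcnd
  have hcnd0 : ∀ c : Fin 5 ⊕ Fin 5 → ℝ, ∑ r, c r = 0 → dotProduct c ((skelA d).mulVec c) ≤ 0 := by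
    intro c hc
    have h1 := hcnd c hc
    have h2 : 0 ≤ dotProduct c c := Finset.sum_nonneg fun i _ => mul_self_nonneg (c i)
    nlinarith
  exact ⟨hA, hs, gap_of_certM d hwin C g t hC hMlo hMhi hA hs.ne' hcnd0⟩

end TwoHoleBS

end Summit.HubbardSuperconductivity.HubbardSuperconductivity.Theorems.AnisotropyChord.Transfer.Fibre3

end
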